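import Summits.HubbardSuperconductivity.HubbardSuperconductivity.Theorems.AnisotropyChordTransferFibre3FinX3Eval

/-!
# Route `AnisotropyChord` / H0 rotor rung: FIN per-`L` GM₃ (X5), `L = 34` — rows `N₁` / D / side-condition cell facts, part `p17`

Kernel facts (`decide +kernel`) for cert cells 54, 55 of the per-`L` grid of `L = 34`: `xbnCellAny2` (row `N₁` on XB2 point wedges recomputed in the kernel, exporting the literal brackets `nt ⊇ T⁺ − 3λ₂` and `tb ⊇ T⁺·D`), `xdCellAnyN0` (row D, reads `nt`), `sdCellAnyZN` (side condition, reads `nt`); evaluators `…FinX3Eval` / `…FinX5Eval`; constants from the compiled design probe (x3probe/x3plan, margins c ×0.985, b ×1.03, aD ×1.03); assembled in `…FinX5GM3ThirtyFour`.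
Prover seat `hubbard-h0-rotor-p3` g8; helper for piece A = stmt-HubbardSuperconductivity-23918 of rung 19089 (`--supports`, helper class).
WHAT THIS IS NOT: nothing here proves superconductivity in the Hubbard model (rotor TARGET as worded stays FALSE, g15 verdict); kernel facts for the FIN certificate of ONE conditional reduction.  Tree imports only; zero data; standard axioms.
-/

set_option linter.dupNamespace false
set_option autoImplicit false

namespace Summit.HubbardSuperconductivity.HubbardSuperconductivity.Theorems.AnisotropyChord.Transfer.Fibre3

namespace FinXD

open FinXB FinCell Hole2

set_option maxHeartbeats 4000000 in
/-- row `N₁` of cell 54 of `L = 34` (`c = 61/100`), exporting `nt`, `tb`. [folklore] -/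
theorem xn34_54 : xbnCellAny2 34 (49/50 : ℚ) 171113877511002 175391724448777 (61/100 : ℚ) ((-1062824145098 : ℤ), (1313577332763 : ℤ)) ((512275675199233 : ℤ), (527491883867769 : ℤ)) = true := by decide +kernel

set_option maxHeartbeats 4000000 in
/-- row D of cell 54 of `L = 34` (`aD = 43/500`). [folklore] -/
theorem xd34_54 : xdCellAnyN0 34 (49/50 : ℚ) 171113877511002 175391724448777 (43/500 : ℚ) ((-1062824145098 : ℤ), (1313577332763 : ℤ)) = true := by decide +kernel

set_option maxHeartbeats 4000000 in
/-- side condition of cell 54 of `L = 34` (`c, b = 57/100, aD`). [folklore] -/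
theorem sd34_54 : sdCellAnyZN 34 (49/50 : ℚ) 100 171113877511002 175391724448777 ((61/100 : ℚ), (57 : ℕ), (43/500 : ℚ)) ((-1062824145098 : ℤ), (1313577332763 : ℤ)) = true := by decide +kernel

set_option maxHeartbeats 4000000 in
/-- row `N₁` of cell 55 of `L = 34` (`c = 61/100`), exporting `nt`, `tb`. [folklore] -/
theorem xn34_55 : xbnCellAny2 34 (49/50 : ℚ) 175391724448777 179776517559998 (61/100 : ℚ) ((-1048527300457 : ℤ), (1320695208532 : ℤ)) ((525123434527482 : ℤ), (540653459406918 : ℤ)) = true := by decide +kernel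

set_option maxHeartbeats 4000000 in
/-- row D of cell 55 of `L = 34` (`aD = 43/500`). [folklore] -/
theorem xd34_55 : xdCellAnyN0 34 (49/50 : ℚ) 175391724448777 179776517559998 (43/500 : ℚ) ((-1048527300457 : ℤ), (1320695208532 : ℤ)) = true := by decide +kernel

set_option maxHeartbeats 4000000 in
/-- side condition of cell 55 of `L = 34` (`c, b = 58/100, aD`). [folklore] -/
theorem sd34_55 : sdCellAnyZN 34 (49/50 : ℚ) 100 175391724448777 179776517559998 ((61/100 : ℚ), (58 : ℕ), (43/500 : ℚ)) ((-1048527300457 : ℤ), (1320695208532 : ℤ)) = true := by decide +kernel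

end FinXD

end Summit.HubbardSuperconductivity.HubbardSuperconductivity.Theorems.AnisotropyChord.Transfer.Fibre3
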